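import Mathlib

/-!
# The p-free outer cone system in (v, U, Q) (K36)

Solo seat `solo-NavierStokesRegularity-informed`, session 15; companion of `paper/axisymmetric-rigidity.md` §5k, LEMMA 8.31(b).
Along the polar sector of a smooth swirling cone `(z₁, σ)` the first integral (K35) reads
`v² + s² + 2p + u + u² = (2σ/sin z₁)·s·sin φ`. With `s_sl := σ sin φ / sin z₁`, `U := 1 + 2u + 2v cot φ`, `Q := s/s_sl - 1`,
`v_sl := (3/2) sin φ (sin φ cos z₁ - cos φ sin z₁)/sin z₁` the cone system (S) becomes the closed system
* `outerReduced_strain`: `v u' = 2v² + 2 s (s - s_sl)`;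
* `outerReduced_v`: `v' = 3/2 + 2 v cot φ - (3/2) U`;
* `outerReduced_Q`: `Q' = -(1 + Q) U / v`;
* `outerReduced_U`: `U' = 4v + 3cot φ - 3U cot φ + 4 v cot²φ - 2v/sin²φ + 4 s_sl² (1+Q) Q / v` (with `(cot φ)' = -1/sin²φ` as input), and
  `outerReduced_U_pythagoras`: `4v + 4v cot²φ - 2v/sin²φ = 2v/sin²φ` under `sin² + cos² = 1`;
* `outerReduced_slowForcing`: `3 cot φ + 2 v_sl/sin²φ = 3 cot z₁` (so the fast pair `(U, Q)` is forced only through `3cot z₁ + 2(v - v_sl)/sin²φ`).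
Here `sin φ, cos φ, sin z₁, cos z₁` enter as real variables `sφ, cφ, sz, cz`; no trigonometry is used beyond the stated constraint.
No new definitions; axioms: standard.
-/

namespace Summit.NavierStokesRegularity.NavierStokesRegularity.Theorems

/-- Strain equation with `p` eliminated by the first integral: `v u' = 2v² + 2s(s - s_sl)`. -/
theorem outerReduced_strain (u v s p σ sφ sz : ℝ)
    (hFI : v ^ 2 + s ^ 2 + 2 * p + u + u ^ 2 = 2 * σ / sz * s * sφ) :
    v ^ 2 + s ^ 2 - 2 * p - u - u ^ 2 = 2 * v ^ 2 + 2 * s * (s - σ * sφ / sz) := by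
  linear_combination (-1 : ℝ) * hFI

/-- Divergence equation in terms of `U`: `v' = 3/2 + 2v cot φ - (3/2)U`. -/
theorem outerReduced_v (u v cot dv : ℝ) (hdv : dv = -3 * u - v * cot) :
    dv = 3 / 2 + 2 * v * cot - 3 / 2 * (1 + 2 * u + 2 * v * cot) := by
  subst hdv
  ring

/-- Swirl excess: `Q := s/s_sl - 1` obeys `Q' = -(1+Q) U / v`. -/
theorem outerReduced_Q (u v s σ sφ cφ sz ds : ℝ) (hv : v ≠ 0) (hsφ : sφ ≠ 0) (hσ : σ ≠ 0)
    (hds : ds = -s * (1 + 2 * u + v * (cφ / sφ)) / v) :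
    ds / (σ * sφ / sz) - s * (σ * cφ / sz) / (σ * sφ / sz) ^ 2
      = -(1 + (s / (σ * sφ / sz) - 1)) * (1 + 2 * u + 2 * v * (cφ / sφ)) / v := by
  subst hds
  field_simp
  ring

/-- Fast variable: `U := 1 + 2u + 2v cot φ` obeys
`U' = 4v + 3cot φ - 3U cot φ + 4v cot²φ - 2v/sin²φ + 4 s_sl²(1+Q)Q/v`, given `(cot φ)' = -1/sin²φ`. -/
theorem outerReduced_U (u v s σ sφ cφ sz du dv : ℝ) (hv : v ≠ 0) (hsφ : sφ ≠ 0) (hsz : sz ≠ 0) (hσ : σ ≠ 0)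
    (hdu : du = (2 * v ^ 2 + 2 * s * (s - σ * sφ / sz)) / v) (hdv : dv = -3 * u - v * (cφ / sφ)) :
    2 * du + 2 * dv * (cφ / sφ) + 2 * v * (-1 / sφ ^ 2)
      = 4 * v + 3 * (cφ / sφ) - 3 * (1 + 2 * u + 2 * v * (cφ / sφ)) * (cφ / sφ) + 4 * v * (cφ / sφ) ^ 2 - 2 * v / sφ ^ 2
        + 4 * (σ * sφ / sz) ^ 2 * (1 + (s / (σ * sφ / sz) - 1)) * (s / (σ * sφ / sz) - 1) / v := by
  subst hdu hdv
  field_simp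
  ring

/-- The Pythagorean simplification `4v + 4v cot²φ - 2v/sin²φ = 2v/sin²φ`. -/
theorem outerReduced_U_pythagoras (v sφ cφ : ℝ) (hsφ : sφ ≠ 0) (hPy : sφ ^ 2 + cφ ^ 2 = 1) :
    4 * v + 4 * v * (cφ / sφ) ^ 2 - 2 * v / sφ ^ 2 = 2 * v / sφ ^ 2 := by
  field_simp
  linear_combination (4 * v) * hPy

/-- The slow forcing is constant along the slow family: `3 cot φ + 2 v_sl/sin²φ = 3 cot z₁`. -/
theorem outerReduced_slowForcing (sφ cφ sz cz : ℝ) (hsφ : sφ ≠ 0) (hsz : sz ≠ 0) :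
    3 * (cφ / sφ) + 2 * (3 / 2 * sφ * (sφ * cz - cφ * sz) / sz) / sφ ^ 2 = 3 * (cz / sz) := by
  field_simp
  ring

end Summit.NavierStokesRegularity.NavierStokesRegularity.Theorems
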